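import Literature.NumberTheory.Rogawski1990.UnitOrbitalIntegralInertValueThetaZeroCorner
import HarnessLib

/-!
# The `θ̄ = 0` value from Flicker's TRICHOTOMY datum: `#Fix_{U⧸K}(t(a,b,c)) = φ₀(N₁, N₂, N)` with `N₊` and the type datum DERIVED
(Flicker (1998), *Elementary proof of the fundamental lemma for a unitary group*, Prop. 14 p. 94; §6 p. 95)

Topic `NumberTheory/Rogawski1990` (road «D-N7-inert», MAP v3 LAYER C → (F12) value stub `X₁`, layer (ii-a′)); namespace `Literature.NumberTheory.Automorphic.UnitaryGroup`.
THEOREMS ONLY; kernel lane.  Pen F0P3b-p01 (g6).  HONEST LABEL: HC_CM is proved only modulo the 2 remaining named inputs (hLiu418, h413) until rung 0 closes.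

The (F12) value stub `stub_splitGValue1` (p04 (g12)'s ED. 1.5 fragment) carries the orders in the form `|α − γ| = exp(−N)`, `|α − β| = exp(−N₁)`, `|γ − β| = exp(−N₂)` and the
trichotomy `htri : (N₁ = N₂ ∧ N₁ ≤ N) ∨ (N₁ = N ∧ N₁ ≤ N₂) ∨ (N₂ = N ∧ N₂ ≤ N₁)` — NOT `N₊ = ord(a + c − 2b)` nor the type datum of ★ `sumThetaZero_eq_phiZero`.  This file derives
both: `a + c ≠ 2b` for norm-one `a ≠ c` (`(a − c)² = (a + c)² − 4ac = 0` otherwise), `N₊ := −log|a + c − 2b|`, type A `N₁ = N₂ < N ⟹ N₊ = N₁` (`a + c − 2b = 2(a−b) − (a−c)`), type B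
`N = min(N₁,N₂) ⟹ N ≤ N₊` (ultrametric) — and feeds ★ `natCard_fixedPoints_unitaryInt_corner_eq_phiZero`.

## References
* [Flicker1998UnitaryFL] Y. Z. Flicker, *Elementary proof of the fundamental lemma for a unitary group*, Canad. J. Math. 50 (1998), 74–98.
* [Rogawski1990] J. D. Rogawski, *Automorphic Representations of Unitary Groups in Three Variables* (1990), §4.9 p. 55.
-/

set_option autoImplicit false

open scoped MatrixGroups WithZero Valued
open Matrix

namespace Literature.NumberTheory.Automorphic

namespace UnitaryGroup

open Literature.NumberTheory.Automorphic.HermitianLattice (unitaryInt mem_unitaryInt_iff LocalConjDatum)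
open Literature.NumberTheory.Rogawski1990.Flicker1998 (phiZero)
open IsLocalRing

variable {K : Type*} [Field K] [Valued K ℤᵐ⁰] {ϖ : K} (σ : K →+* K) {J : Matrix (Fin 3) (Fin 3) K}

/-- **`a + c ≠ 2b` for norm-one `a, b, c` with `a ≠ c`** (`|2| = 1`): from `2b = a + c` and `σz = z⁻¹`, `(a + c)² = 4ac`, i.e. `(a − c)² = 0`.
[cite: Flicker1998UnitaryFL, Prop. 13 p. 91] -/
theorem add_sub_two_mul_ne_zero_of_normOne (hd : LocalConjDatum σ ϖ) {a b cc : K}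
    (ha : σ a * a = 1) (hb : σ b * b = 1) (hcc : σ cc * cc = 1) (hac : a ≠ cc) : a + cc - 2 * b ≠ 0 := by
  intro hs
  have h2v : Valued.v (2 : K) = 1 := hd.v2
  have h2 : (2 : K) ≠ 0 := fun h => by rw [h, map_zero] at h2v; exact zero_ne_one h2v
  have ha0 : a ≠ 0 := fun h => by rw [h, mul_zero] at ha; exact zero_ne_one ha
  have hb0 : b ≠ 0 := fun h => by rw [h, mul_zero] at hb; exact zero_ne_one hb
  have hc0 : cc ≠ 0 := fun h => by rw [h, mul_zero] at hcc; exact zero_ne_one hcc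
  have hσa : σ a = a⁻¹ := eq_inv_of_mul_eq_one_left ha
  have hσb : σ b = b⁻¹ := eq_inv_of_mul_eq_one_left hb
  have hσc : σ cc = cc⁻¹ := eq_inv_of_mul_eq_one_left hcc
  have hb2 : 2 * b = a + cc := by linear_combination -hs
  -- apply `σ`: `2 b⁻¹ = a⁻¹ + c⁻¹`
  have hσ2 : σ (2 * b) = σ (a + cc) := by rw [hb2]
  rw [map_mul, map_ofNat, map_add, hσa, hσb, hσc] at hσ2
  have key : (a - cc) ^ 2 = 0 := by
    field_simp at hσ2
    linear_combination (-(a + cc)) * hb2 - 2 * hσ2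
  exact hac (sub_eq_zero.1 (pow_eq_zero_iff two_ne_zero |>.1 key))

section Tri

variable [IsDiscreteValuationRing 𝒪[K]] [Finite (ResidueField 𝒪[K])] [IsAdicComplete (maximalIdeal 𝒪[K]) 𝒪[K]]

set_option synthInstance.maxHeartbeats 200000 in
-- the `H`-action on `H ⧸ (K^{u_m} ∩ H)` (as in ★ (F2))
/-- **`#Fix_{U⧸K}(t(a,b,c)) = φ₀(N₁,N₂,N)` from the trichotomy datum** (`N₊` and the type datum derived inside). [cite: Flicker1998UnitaryFL, Prop. 14 p. 94; §6 p. 95] -/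
theorem natCard_fixedPoints_unitaryInt_corner_eq_phiZero_of_tri (hJ : J = (StdForm.antidiagonal 3).over K) (hd : LocalConjDatum σ ϖ)
    (hσO : ∀ y : 𝒪[K], (σ.comp 𝒪[K].subtype) y ∈ 𝒪[K]) {y : K} (hy : y * σ y = -2)
    {q : ℕ} (hq : Nat.card (ResidueField 𝒪[K]) = q ^ 2)
    {a₀ : 𝒪[K]} (ha₀ : IsUnit (((σ.comp 𝒪[K].subtype).codRestrict 𝒪[K] hσO) a₀ - a₀))
    {e a b cc : K} (h2e : 2 * e = 1) (ha : σ a * a = 1) (hb : σ b * b = 1) (hcc : σ cc * cc = 1)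
    {t : ↥(unitaryGroupOfForm σ J)}
    (hte : ((t : GL (Fin 3) K) : Matrix (Fin 3) (Fin 3) K) = !![e * (a + cc), 0, -(e * (a - cc)); 0, b, 0; -(e * (a - cc)), 0, e * (a + cc)])
    {N N₁ N₂ : ℕ} (hN : Valued.v (a - cc) = WithZero.exp (-(N : ℤ))) (hN₁ : Valued.v (a - b) = WithZero.exp (-(N₁ : ℤ)))
    (hN₂ : Valued.v (cc - b) = WithZero.exp (-(N₂ : ℤ)))
    (htri : (N₁ = N₂ ∧ N₁ ≤ N) ∨ (N₁ = N ∧ N₁ ≤ N₂) ∨ (N₂ = N ∧ N₂ ≤ N₁))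
    (hfin : {x : ↥(unitaryGroupOfForm σ J) ⧸ unitaryInt σ J | t • x = x}.Finite) :
    (Nat.card {x : ↥(unitaryGroupOfForm σ J) ⧸ unitaryInt σ J | t • x = x} : ℚ) = phiZero q N₁ N₂ N := by
  have h2v : Valued.v (2 : K) = 1 := hd.v2
  have hϖ0 : ϖ ≠ 0 := hd.ϖ_ne_zero
  have hac : a ≠ cc := by
    intro h; rw [h, sub_self, map_zero] at hN; exact WithZero.zero_ne_coe hN
  -- `N₊ := ord(a + c − 2b)`
  have hs0 : a + cc - 2 * b ≠ 0 := add_sub_two_mul_ne_zero_of_normOne σ hd ha hb hcc hac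
  have hvs0 : Valued.v (a + cc - 2 * b) ≠ 0 := (Valuation.ne_zero_iff _).2 hs0
  have hva : Valued.v a ≤ 1 := by
    have h1 := congrArg Valued.v ha; rw [map_mul, hd.vσ, map_one] at h1
    exact (Literature.NumberTheory.QuadraticForms.OMeara65.WithZeroMulInt.eq_one_of_mul_self h1).le
  have hvb : Valued.v b ≤ 1 := by
    have h1 := congrArg Valued.v hb; rw [map_mul, hd.vσ, map_one] at h1
    exact (Literature.NumberTheory.QuadraticForms.OMeara65.WithZeroMulInt.eq_one_of_mul_self h1).le
  have hvc : Valued.v cc ≤ 1 := by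
    have h1 := congrArg Valued.v hcc; rw [map_mul, hd.vσ, map_one] at h1
    exact (Literature.NumberTheory.QuadraticForms.OMeara65.WithZeroMulInt.eq_one_of_mul_self h1).le
  have hvs1 : Valued.v (a + cc - 2 * b) ≤ 1 := by
    refine le_trans (Valuation.map_sub _ _ _) (max_le (le_trans (Valuation.map_add _ _ _) (max_le hva hvc)) ?_)
    rw [map_mul, h2v, one_mul]; exact hvb
  obtain ⟨Np, hNp⟩ : ∃ Np : ℕ, Valued.v (a + cc - 2 * b) = WithZero.exp (-(Np : ℤ)) := by
    refine ⟨(-WithZero.log (Valued.v (a + cc - 2 * b))).toNat, ?_⟩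
    have hlog : WithZero.log (Valued.v (a + cc - 2 * b)) ≤ 0 := by
      rw [← WithZero.exp_le_exp, WithZero.exp_log hvs0, WithZero.exp_zero]; exact hvs1
    rw [Int.toNat_of_nonneg (by omega), neg_neg, WithZero.exp_log hvs0]
  -- the orders in `|ϖ^n|` form
  rw [← hd.v_pow] at hN hN₁ hN₂ hNp
  -- the type datum
  have vle : ∀ {i j : ℕ}, Valued.v (ϖ ^ i) ≤ Valued.v (ϖ ^ j) ↔ j ≤ i := fun {i j} => by rw [hd.v_pow, hd.v_pow, WithZero.exp_le_exp]; omega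
  have vlt : ∀ {i j : ℕ}, Valued.v (ϖ ^ i) < Valued.v (ϖ ^ j) ↔ j < i := fun {i j} => by rw [hd.v_pow, hd.v_pow, WithZero.exp_lt_exp]; omega
  have hvbc : Valued.v (b - cc) = Valued.v (ϖ ^ N₂) := by rw [← Valuation.map_sub_swap, hN₂]
  have hNple : Valued.v (a + cc - 2 * b) ≤ max (Valued.v (a - b)) (Valued.v (cc - b)) := by
    have e1 : a + cc - 2 * b = (a - b) + (cc - b) := by ring
    rw [e1]; exact Valuation.map_add _ _ _
  have h : (N₁ < N ∧ N₂ = N₁ ∧ Np = N₁) ∨ (N ≤ N₁ ∧ N ≤ Np) := by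
    rcases htri with ⟨h12, h1N⟩ | ⟨h1N, h12⟩ | ⟨h2N, h21⟩
    · rcases lt_or_eq_of_le h1N with hlt | heq
      · -- type A: `N₊ = N₁`
        refine Or.inl ⟨hlt, h12.symm, ?_⟩
        have e1 : a + cc - 2 * b = 2 * (a - b) + (-(a - cc)) := by ring
        have hv2ab : Valued.v (2 * (a - b)) = Valued.v (ϖ ^ N₁) := by rw [map_mul, h2v, one_mul, hN₁]
        have hlt' : Valued.v (-(a - cc)) < Valued.v (2 * (a - b)) := by rw [Valuation.map_neg, hN, hv2ab, vlt]; exact hlt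
        have := Valuation.map_add_eq_of_lt_left _ hlt'  -- ? shape `v (x + y) = v x` when `v y < v x`
        rw [← e1, hv2ab] at this
        rw [hNp, hd.v_pow, hd.v_pow, WithZero.exp_inj] at this
        omega
      · refine Or.inr ⟨by omega, ?_⟩
        have hle := hNple
        rw [hN₁, hN₂, hNp, ← h12, heq, max_self, vle] at hle
        exact hle
    · refine Or.inr ⟨by omega, ?_⟩
      have hle := hNple
      rw [hN₁, hN₂, hNp, h1N] at hle
      have : max (Valued.v (ϖ ^ N)) (Valued.v (ϖ ^ N₂)) = Valued.v (ϖ ^ N) := max_eq_left (by rw [vle]; omega)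
      rw [this, vle] at hle
      exact hle
    · refine Or.inr ⟨by omega, ?_⟩
      have hle := hNple
      rw [hN₁, hN₂, hNp, h2N] at hle
      have : max (Valued.v (ϖ ^ N₁)) (Valued.v (ϖ ^ N)) = Valued.v (ϖ ^ N) := max_eq_right (by rw [vle]; omega)
      rw [this, vle] at hle
      exact hle
  exact natCard_fixedPoints_unitaryInt_corner_eq_phiZero σ hJ hd hσO hy hq ha₀ h2e ha hb hcc hte hN hNp hN₁ hN₂ h hfin

end Tri

end UnitaryGroup

end Literature.NumberTheory.Automorphic
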